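import Literature.Geometry.GaugeTheory.BPSTModuli
import Literature.Geometry.GaugeTheory.BPSTInformationMetric
import Literature.Geometry.GaugeTheory.InstantonEntropy
import Literature.Geometry.Riemannian.GaussianShrinker
import Mathlib.Geometry.Manifold.MFDeriv.NormedSpace
import HarnessLib

/-!
# The information metric of the BPST family in `M₁(ℝ⁴)`: the flat case of the
# Groisser–Murray collar asymptotics, exactly

Topic `Literature/Geometry/GaugeTheory`; companion of `InstantonCollarInformationMetric.lean` (the
cited fact `informationMetric_collarAsymptotics`, Groisser–Murray 1997 Thm. 3.1 over a homotopy
4-sphere) and of `BPSTInstanton.lean` / `BPSTModuli.lean` / `BPSTInformationMetric.lean`.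

Over FLAT `ℝ⁴` (the tree's model: `X = ℝ⁴`, `g = euclideanMetric`, standard orientation, the
two-patch `Sp(1)`-connections of `AsdModuliSpace.lean`) the scale-and-centre family of
Groisser–Murray's collar is the explicit BPST family `Ψ₀(a, λ) = [A_{a,λ}] ∈ M₁(ℝ⁴)`
(`BPST.moduliMap`), and the clauses of the fact hold for it in the SAME vocabulary
(`AsdModuliSpace.density`, `mvfderiv` on `(𝓡 4).prod 𝓘(ℝ, ℝ)`, `volMeasure`, `g.val`), the
information-metric clause even EXACTLY (error `ε = 0`, every `λ > 0`):

* `BPST.injOn_moduliMap` — `Ψ₀` is injective on `ℝ⁴ × (0, ∞)`;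
* `BPST.contMDiffOn_density_moduliMap` — `((a, λ), x) ↦ ρ_{Ψ₀(a,λ)}(x) = 48λ⁴/(λ² + ‖x − a‖²)⁴`
  is smooth on `(ℝ⁴ × (0, ∞)) × ℝ⁴` for the product model with corners;
* `BPST.exists_le_density_moduliMap` — `sup_x ρ_{Ψ₀(a,λ)}(x) = 48/λ⁴ → ∞` uniformly as `λ → 0`;
* `BPST.integral_fisherRao_moduliMap` — **Hitchin's theorem / GM's leading term, flat case**:
  `∫ (∂_{(v,s)} ρ_{Ψ₀})² / ρ_{Ψ₀(σ,λ)} dvol_δ = (128π²/5) (s² + δ(v, v))/λ²`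
  for every `σ ∈ ℝ⁴`, `λ > 0`, `(v, s) ∈ T_{(σ,λ)}(ℝ⁴ × ℝ)`: the information metric of the
  five-parameter instanton family is `c (dλ² + δ)/λ²`, the hyperbolic metric of the upper half
  space `H⁵`, with `c = 128π²/5` (Groisser–Murray 1997, §3, p. 7: both radial integrals equal
  `1/60`; Hitchin 1990 for `M₁(S⁴)`);
* `BPST.informationMetric_moduliMap` — injectivity and the last three clauses of
  `informationMetric_collarAsymptotics` bundled in its exact shape (with `c = 128π²/5`, any
  `ε > 0`, on `ℝ⁴ × (0, t)` for every `t > 0`).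

Bridging lemmas (the fact is phrased with manifold derivatives and the Riemannian measure):
`mfderiv_prod_self_eq_fderiv` / `mvfderiv_prod_self_apply` (on a product of model vector spaces
`mvfderiv` is the Fréchet derivative) and `integral_volMeasure_euclideanMetric`
(`dvol_δ = Lebesgue measure` on `ℝ⁴`, from `riemannianMeasure_euclideanFour` of `GaussianShrinker.lean`).

What is NOT here: anything over a curved or compact base (Taubes' existence, the collar theorem,
GM's error terms) — this is the `ε = 0` model computation behind GM (3.8)–Thm. 3.1.

## References

* D. Groisser, M. K. Murray, *Instantons and the information metric*, Ann. Global Anal. Geom. 15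
  (1997) 519–537, §3 (p. 7: the five-parameter family on `ℝ⁴`, `c₁ = c₂`). [GroisserMurray1997]
* N. J. Hitchin, *The geometry and topology of moduli spaces*, in: Global Geometry and
  Mathematical Physics (Montecatini Terme 1988), LNM 1451 (1990), pp. 1–48 (the information
  metric of `M₁(S⁴)` is the hyperbolic metric).
* G. L. Naber, *Topology, Geometry, and Gauge Fields* (1997), §5.3. [Naber1997]
-/

noncomputable section

open scoped Manifold ContDiff Topology RealInnerProductSpace
open Set Function MeasureTheory Filter
open Literature.Geometry.Riemannian (euclideanMetric euclideanMetric_apply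
  isRiemannian_euclideanMetric euclideanFourMetric riemannianMeasure_euclideanFour)
open Literature.Geometry.Lorentzian (riemannianMeasure)
open Literature.Topology.FourManifolds

namespace Literature.Geometry.GaugeTheory

/-! ### Bridging lemmas: manifold derivatives on products of model spaces; `dvol_δ = dx` -/

/-- On a product `E × F` of model vector spaces, charted by the product of the identity charts
(model with corners `𝓘(ℝ, E).prod 𝓘(ℝ, F)`), the manifold derivative of a map into a normed
space is its Fréchet derivative. [folklore] -/
theorem mfderiv_prod_self_eq_fderiv {E F G : Type*} [NormedAddCommGroup E] [NormedSpace ℝ E]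
    [NormedAddCommGroup F] [NormedSpace ℝ F] [NormedAddCommGroup G] [NormedSpace ℝ G]
    (f : E × F → G) (x : E × F) :
    mfderiv (𝓘(ℝ, E).prod 𝓘(ℝ, F)) 𝓘(ℝ, G) f x = fderiv ℝ f x := by
  have h : mfderiv 𝓘(ℝ, E × F) 𝓘(ℝ, G) f x = fderiv ℝ f x := mfderiv_eq_fderiv
  rw [modelWithCornersSelf_prod, ← chartedSpaceSelf_prod] at h
  exact h

/-- `mvfderiv` (the manifold derivative read in the target normed space) on a product of model
vector spaces, applied to a tangent vector, is the Fréchet derivative applied to it. [folklore] -/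
theorem mvfderiv_prod_self_apply {E F G : Type*} [NormedAddCommGroup E] [NormedSpace ℝ E]
    [NormedAddCommGroup F] [NormedSpace ℝ F] [NormedAddCommGroup G] [NormedSpace ℝ G]
    (f : E × F → G) (x : E × F) (w : E × F) :
    mvfderiv (𝓘(ℝ, E).prod 𝓘(ℝ, F)) f x w = fderiv ℝ f x w := by
  rw [← mfderiv_prod_self_eq_fderiv]
  rfl

/-- **`dvol_δ = dx` for the tree's `volMeasure`**: integration against the Riemannian measure
`volMeasure (euclideanMetric ℝ⁴) _` (which lives on the abstract Borel σ-algebra `borel ℝ⁴`) is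
integration against Lebesgue measure (`riemannianMeasure_euclideanFour` of `GaussianShrinker.lean`,
transported across the two — propositionally equal — measurable-space structures). [folklore] -/
theorem integral_volMeasure_euclideanMetric
    (hg : (euclideanMetric (EuclideanSpace ℝ (Fin 4))).IsRiemannian)
    (f : EuclideanSpace ℝ (Fin 4) → ℝ) :
    ∫ x, f x ∂(volMeasure (euclideanMetric (EuclideanSpace ℝ (Fin 4))) hg) = ∫ x, f x := by
  have key : ∀ (m₁ m₂ : MeasurableSpace (EuclideanSpace ℝ (Fin 4))) (_ : m₁ = m₂)
      (hb₁ : @BorelSpace (EuclideanSpace ℝ (Fin 4)) _ m₁)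
      (hb₂ : @BorelSpace (EuclideanSpace ℝ (Fin 4)) _ m₂),
      (letI := m₁; haveI := hb₁; ∫ x, f x ∂(riemannianMeasure euclideanFourMetric)) =
        (letI := m₂; haveI := hb₂; ∫ x, f x ∂(riemannianMeasure euclideanFourMetric)) := by
    intro m₁ m₂ h hb₁ hb₂
    subst h
    obtain rfl : hb₁ = hb₂ := Subsingleton.elim _ _
    rfl
  have h2 := key (borel _) _
    (BorelSpace.measurable_eq (α := EuclideanSpace ℝ (Fin 4))).symm
    (@BorelSpace.mk _ _ (borel _) rfl) inferInstance
  rw [riemannianMeasure_euclideanFour] at h2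
  exact h2

namespace BPST

/-! ### The BPST family as a map into `M₁(ℝ⁴)` -/

/-- **The BPST family in the moduli space**: `Ψ₀(a, λ) = [A_{a,λ}] ∈ M₁(ℝ⁴)`, the gauge class of
the BPST instanton of centre `a` and scale `λ` (`BPST.instanton`), as a map on all of `ℝ⁴ × ℝ`
(at the excluded value `λ = 0` it is given the junk value `[A_{a,1}]`; only `λ > 0` is ever used).
This is the flat-space model of the scale-and-centre collar map `Ψ` of
`informationMetric_collarAsymptotics` (Groisser–Murray 1997, §3, p. 6; Donaldson 1983).
[cite: GroisserMurray1997, §3 p. 6] -/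
def moduliMap (q : EuclideanSpace ℝ (Fin 4) × ℝ) :
    AsdModuliSpace (euclideanMetric (EuclideanSpace ℝ (Fin 4))) (SmoothOrientation.euclidean 4) 1 :=
  if h : q.2 = 0 then
    AsdModuliSpace.mk (instanton q.1 (basePoint (EuclideanSpace ℝ (Fin 4))) (l := 1) one_ne_zero)
  else AsdModuliSpace.mk (instanton q.1 (basePoint (EuclideanSpace ℝ (Fin 4))) h)

/-- Off `λ = 0` the family is the class of the BPST instanton `A_{a,λ}`. [cite: GroisserMurray1997, §3 p. 6] -/
theorem moduliMap_eq (a : EuclideanSpace ℝ (Fin 4)) {l : ℝ} (hl : l ≠ 0) :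
    moduliMap (a, l) =
      AsdModuliSpace.mk (instanton a (basePoint (EuclideanSpace ℝ (Fin 4))) hl) := by
  simp [moduliMap, hl]

/-- The density of `Ψ₀(a, λ)` is the BPST density `ρ_{a,λ} = 48λ⁴/(λ² + ‖· − a‖²)⁴` (`λ ≠ 0`).
[cite: Naber1997, §5.3 Exercise 5.3.1] -/
theorem density_moduliMap (a : EuclideanSpace ℝ (Fin 4)) {l : ℝ} (hl : l ≠ 0) :
    (moduliMap (a, l)).density (euclideanMetric (EuclideanSpace ℝ (Fin 4))) = bpstDensity a l := by
  rw [moduliMap_eq a hl, density_mk_instanton]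

/-- Pointwise form of `density_moduliMap`. [cite: Naber1997, §5.3 Exercise 5.3.1] -/
theorem density_moduliMap_apply (a : EuclideanSpace ℝ (Fin 4)) {l : ℝ} (hl : l ≠ 0)
    (x : EuclideanSpace ℝ (Fin 4)) :
    (moduliMap (a, l)).density (euclideanMetric (EuclideanSpace ℝ (Fin 4))) x =
      48 * l ^ 4 / (l ^ 2 + ‖x - a‖ ^ 2) ^ 4 := by
  rw [density_moduliMap a hl, bpstDensity_apply]

/-! ### Clause: injectivity of the family -/

/-- **`Ψ₀` is injective on `ℝ⁴ × (0, ∞)`** (distinct centres or scales give gauge inequivalent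
instantons, `BPST.mk_instanton_injective`) — the flat case of the clause `InjOn Ψ (univ ×ˢ Ioo 0 l₀)`.
[cite: GroisserMurray1997, §3 p. 6] -/
theorem injOn_moduliMap : InjOn moduliMap ((univ : Set (EuclideanSpace ℝ (Fin 4))) ×ˢ Ioi 0) := by
  rintro ⟨a, l⟩ ⟨-, hl⟩ ⟨a', l'⟩ ⟨-, hl'⟩ h
  rw [mem_Ioi] at hl hl'
  change moduliMap (a, l) = moduliMap (a', l') at h
  rw [moduliMap_eq a hl.ne', moduliMap_eq a' hl'.ne'] at h
  obtain ⟨rfl, rfl⟩ := mk_instanton_injective hl hl' h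
  rfl

/-! ### Clause: joint smoothness of the densities -/

/-- **The densities depend smoothly on centre, scale and point**: `((a, λ), x) ↦ ρ_{Ψ₀(a,λ)}(x)`
is `C^∞` on `(ℝ⁴ × (0, ∞)) × ℝ⁴` for the product model with corners
`((𝓡 4).prod 𝓘(ℝ, ℝ)).prod (𝓡 4)` — the flat case of the `ContMDiffOn` clause of
`informationMetric_collarAsymptotics` (there on `(Σ × (0, λ₀)) × Σ`). [cite: GroisserMurray1997, §3 p. 7] -/
theorem contMDiffOn_density_moduliMap :
    ContMDiffOn (((𝓡 4).prod 𝓘(ℝ, ℝ)).prod (𝓡 4)) 𝓘(ℝ, ℝ) ∞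
      (fun q : (EuclideanSpace ℝ (Fin 4) × ℝ) × EuclideanSpace ℝ (Fin 4) ↦
        (moduliMap q.1).density (euclideanMetric (EuclideanSpace ℝ (Fin 4))) q.2)
      (((univ : Set (EuclideanSpace ℝ (Fin 4))) ×ˢ Ioi (0 : ℝ)) ×ˢ univ) := by
  have h1 : ContMDiff (((𝓡 4).prod 𝓘(ℝ, ℝ)).prod (𝓡 4)) 𝓘(ℝ, ℝ) ∞
      (fun q : (EuclideanSpace ℝ (Fin 4) × ℝ) × EuclideanSpace ℝ (Fin 4) ↦ q.1.2) :=
    contMDiff_snd.comp contMDiff_fst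
  have h2 : ContMDiff (((𝓡 4).prod 𝓘(ℝ, ℝ)).prod (𝓡 4)) 𝓘(ℝ, EuclideanSpace ℝ (Fin 4)) ∞
      (fun q : (EuclideanSpace ℝ (Fin 4) × ℝ) × EuclideanSpace ℝ (Fin 4) ↦ q.2 - q.1.1) :=
    contMDiff_snd.sub (contMDiff_fst.comp contMDiff_fst)
  have hφ := h1.prodMk_space h2
  rintro q ⟨⟨-, hl⟩, -⟩
  rw [mem_Ioi] at hl
  have hne : q.1.2 ^ 2 + ‖q.2 - q.1.1‖ ^ 2 ≠ 0 := by positivity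
  have hG : ContDiffAt ℝ ∞
      (fun y : ℝ × EuclideanSpace ℝ (Fin 4) ↦ 48 * y.1 ^ 4 / (y.1 ^ 2 + ‖y.2‖ ^ 2) ^ 4)
      (q.1.2, q.2 - q.1.1) := by
    refine (contDiffAt_const.mul (contDiffAt_fst.pow 4)).div
      (((contDiffAt_fst.pow 2).add (contDiffAt_snd.norm_sq ℝ)).pow 4) ?_
    exact pow_ne_zero _ hne
  refine (ContDiffAt.comp_contMDiffWithinAt
    (f := fun q : (EuclideanSpace ℝ (Fin 4) × ℝ) × EuclideanSpace ℝ (Fin 4) ↦ (q.1.2, q.2 - q.1.1))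
    hG (hφ q).contMDiffWithinAt).congr (fun y hy ↦ ?_) ?_
  · obtain ⟨⟨-, hl'⟩, -⟩ := hy
    rw [mem_Ioi] at hl'
    change (moduliMap (y.1.1, y.1.2)).density _ y.2 = _
    rw [density_moduliMap_apply y.1.1 hl'.ne' y.2]
    rfl
  · change (moduliMap (q.1.1, q.1.2)).density _ q.2 = _
    rw [density_moduliMap_apply q.1.1 hl.ne' q.2]
    rfl

/-! ### Clause: the densities concentrate -/

/-- **`sup_x ρ_{Ψ₀(a,λ)}(x) → ∞` uniformly as `λ → 0`**: for every `R` there is `t > 0` with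
`ρ_{Ψ₀(a,λ)}(a) = 48/λ⁴ ≥ R` whenever `0 < λ < t` — the flat case of the concentration clause of
`informationMetric_collarAsymptotics`. [cite: Naber1997, §5.3 Exercise 5.3.1] -/
theorem exists_le_density_moduliMap (R : ℝ) :
    ∃ t : ℝ, 0 < t ∧ ∀ p ∈ (univ : Set (EuclideanSpace ℝ (Fin 4))) ×ˢ Ioo 0 t,
      ∃ x, R ≤ (moduliMap p).density (euclideanMetric (EuclideanSpace ℝ (Fin 4))) x := by
  have hM : 0 < max R 1 := lt_max_of_lt_right one_pos
  refine ⟨min 1 (48 / max R 1), lt_min one_pos (div_pos (by norm_num) hM), ?_⟩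
  rintro ⟨a, l⟩ ⟨-, hl0, hlt⟩
  refine ⟨a, ?_⟩
  rw [density_moduliMap a hl0.ne', bpstDensity_self a hl0.ne']
  have hl1 : l ≤ 1 := (hlt.trans_le (min_le_left _ _)).le
  have hl2 : l < 48 / max R 1 := hlt.trans_le (min_le_right _ _)
  have hl4 : l ^ 4 ≤ l := by
    calc l ^ 4 = l * (l * l * l) := by ring
      _ ≤ l * 1 := by
          refine mul_le_mul_of_nonneg_left ?_ hl0.le
          calc l * l * l ≤ 1 * 1 * 1 := by gcongr
            _ = 1 := by ring
      _ = l := mul_one l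
  have h48 : 48 / l ≤ 48 / l ^ 4 :=
    div_le_div_of_nonneg_left (by norm_num) (by positivity) hl4
  have hR : max R 1 < 48 / l := by
    rw [lt_div_iff₀ hl0]
    calc max R 1 * l < max R 1 * (48 / max R 1) := by gcongr
      _ = 48 := mul_div_cancel₀ _ hM.ne'
  exact ((le_max_left R 1).trans hR.le).trans h48

/-! ### Clause: the information metric along the family — exactly hyperbolic -/

/-- Near a point with `λ ≠ 0` the densities of the family are the BPST densities, as functions of
the parameter. [cite: Naber1997, §5.3 Exercise 5.3.1] -/
theorem density_moduliMap_eventuallyEq (σ : EuclideanSpace ℝ (Fin 4)) {l : ℝ} (hl : l ≠ 0)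
    (x : EuclideanSpace ℝ (Fin 4)) :
    (fun p : EuclideanSpace ℝ (Fin 4) × ℝ ↦
        (moduliMap p).density (euclideanMetric (EuclideanSpace ℝ (Fin 4))) x) =ᶠ[𝓝 (σ, l)]
      fun p ↦ bpstDensity p.1 p.2 x := by
  have ho : IsOpen {p : EuclideanSpace ℝ (Fin 4) × ℝ | p.2 ≠ 0} :=
    isOpen_ne_fun continuous_snd continuous_const
  filter_upwards [ho.mem_nhds (show ((σ, l) : EuclideanSpace ℝ (Fin 4) × ℝ).2 ≠ 0 from hl)]
    with p hp
  change (moduliMap (p.1, p.2)).density _ x = _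
  rw [density_moduliMap p.1 hp]

/-- The manifold derivative of `p ↦ ρ_{Ψ₀(p)}(x)` at `(σ, λ)`, `λ ≠ 0`, in the direction `(v, s)`,
is the Fréchet derivative of `p ↦ ρ_{p}(x)` (the BPST density as a function of centre and scale).
[cite: GroisserMurray1997, §3 p. 7] -/
theorem mvfderiv_density_moduliMap (σ : EuclideanSpace ℝ (Fin 4)) {l : ℝ} (hl : l ≠ 0)
    (x v : EuclideanSpace ℝ (Fin 4)) (s : ℝ) :
    mvfderiv ((𝓡 4).prod 𝓘(ℝ, ℝ))
        (fun p : EuclideanSpace ℝ (Fin 4) × ℝ ↦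
          (moduliMap p).density (euclideanMetric (EuclideanSpace ℝ (Fin 4))) x) (σ, l) (v, s) =
      fderiv ℝ (fun p : EuclideanSpace ℝ (Fin 4) × ℝ ↦ bpstDensity p.1 p.2 x) (σ, l) (v, s) := by
  rw [mvfderiv_prod_self_apply, (density_moduliMap_eventuallyEq σ hl x).fderiv_eq]

/-- **The information metric of the BPST family is exactly hyperbolic** (Hitchin; Groisser–Murray
1997, §3, p. 7, flat case with no error term): for every centre `σ`, scale `λ > 0` and tangent
vector `(v, s)`,
`∫_{ℝ⁴} (∂_{(v,s)} ρ_{Ψ₀})² / ρ_{Ψ₀(σ,λ)} dvol_δ = (128π²/5) · (s² + δ(v, v)) / λ²`,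
in the vocabulary of `informationMetric_collarAsymptotics` (`mvfderiv` on `(𝓡 4).prod 𝓘(ℝ, ℝ)`,
`AsdModuliSpace.density`, `volMeasure`, `g.val`). [cite: GroisserMurray1997, §3 p. 7] -/
theorem integral_fisherRao_moduliMap
    (hg : (euclideanMetric (EuclideanSpace ℝ (Fin 4))).IsRiemannian)
    (σ : EuclideanSpace ℝ (Fin 4)) {l : ℝ} (hl : 0 < l) (v : EuclideanSpace ℝ (Fin 4)) (s : ℝ) :
    ∫ x, (mvfderiv ((𝓡 4).prod 𝓘(ℝ, ℝ))
            (fun p : EuclideanSpace ℝ (Fin 4) × ℝ ↦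
              (moduliMap p).density (euclideanMetric (EuclideanSpace ℝ (Fin 4))) x) (σ, l) (v, s)) ^ 2 /
          (moduliMap (σ, l)).density (euclideanMetric (EuclideanSpace ℝ (Fin 4))) x
        ∂(volMeasure (euclideanMetric (EuclideanSpace ℝ (Fin 4))) hg) =
      128 * Real.pi ^ 2 / 5 * (s ^ 2 + (euclideanMetric (EuclideanSpace ℝ (Fin 4))).val σ v v) / l ^ 2 := by
  have hv : (euclideanMetric (EuclideanSpace ℝ (Fin 4))).val σ v v = ‖v‖ ^ 2 := by
    rw [euclideanMetric_apply]
    exact real_inner_self_eq_norm_sq v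
  rw [integral_volMeasure_euclideanMetric, hv]
  simp_rw [mvfderiv_density_moduliMap σ hl.ne', density_moduliMap σ hl.ne']
  exact integral_fisherRao_bpstDensity σ hl v s

/-- **Injectivity and the last three clauses of `informationMetric_collarAsymptotics` in the flat
model, in its exact shape** (with `c = 128π²/5`, on `ℝ⁴ × (0, t)` for every `t > 0`; the
information-metric clause holds with error `0 ≤ ε · (…)` for EVERY `λ ∈ (0, t)`): injectivity of
`Ψ₀`, joint smoothness of the densities, concentration, and the `C⁰`-asymptotics
`|𝐠((v,s),(v,s)) − c (s² + δ(v,v))/λ²| ≤ ε · c (s² + δ(v,v))/λ²`. (The topological clauses —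
continuity of `Ψ`, co-compactness, closures — concern the compact base and are not asserted here.)
[cite: GroisserMurray1997, Thm. 3.1, §3 pp. 6–8] -/
theorem informationMetric_moduliMap
    (hg : (euclideanMetric (EuclideanSpace ℝ (Fin 4))).IsRiemannian) {t : ℝ} (ht : 0 < t) :
    InjOn moduliMap ((univ : Set (EuclideanSpace ℝ (Fin 4))) ×ˢ Ioo 0 t) ∧
    ContMDiffOn (((𝓡 4).prod 𝓘(ℝ, ℝ)).prod (𝓡 4)) 𝓘(ℝ, ℝ) ∞
      (fun q : (EuclideanSpace ℝ (Fin 4) × ℝ) × EuclideanSpace ℝ (Fin 4) ↦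
        (moduliMap q.1).density (euclideanMetric (EuclideanSpace ℝ (Fin 4))) q.2)
      (((univ : Set (EuclideanSpace ℝ (Fin 4))) ×ˢ Ioo 0 t) ×ˢ univ) ∧
    (∀ R : ℝ, ∃ t' ∈ Ioo 0 t, ∀ p ∈ (univ : Set (EuclideanSpace ℝ (Fin 4))) ×ˢ Ioo 0 t',
      ∃ x, R ≤ (moduliMap p).density (euclideanMetric (EuclideanSpace ℝ (Fin 4))) x) ∧
    (∀ ε : ℝ, 0 < ε → ∀ (σ : EuclideanSpace ℝ (Fin 4)) (l : ℝ), l ∈ Ioo 0 t →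
      ∀ (v : TangentSpace (𝓡 4) σ) (s : ℝ),
        |(∫ x, (mvfderiv ((𝓡 4).prod 𝓘(ℝ, ℝ))
                  (fun p : EuclideanSpace ℝ (Fin 4) × ℝ ↦
                    (moduliMap p).density (euclideanMetric (EuclideanSpace ℝ (Fin 4))) x)
                  (σ, l) (v, s)) ^ 2 /
                (moduliMap (σ, l)).density (euclideanMetric (EuclideanSpace ℝ (Fin 4))) x
              ∂(volMeasure (euclideanMetric (EuclideanSpace ℝ (Fin 4))) hg)) -
            128 * Real.pi ^ 2 / 5 * (s ^ 2 + (euclideanMetric (EuclideanSpace ℝ (Fin 4))).val σ v v) / l ^ 2|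
          ≤ ε * (128 * Real.pi ^ 2 / 5 *
              (s ^ 2 + (euclideanMetric (EuclideanSpace ℝ (Fin 4))).val σ v v) / l ^ 2)) := by
  refine ⟨injOn_moduliMap.mono (prod_mono le_rfl Ioo_subset_Ioi_self),
    contMDiffOn_density_moduliMap.mono (prod_mono (prod_mono le_rfl Ioo_subset_Ioi_self) le_rfl),
    fun R ↦ ?_, fun ε hε σ l hl v s ↦ ?_⟩
  · obtain ⟨t₁, ht₁, h⟩ := exists_le_density_moduliMap R
    refine ⟨min t₁ t / 2, ⟨by positivity, ?_⟩, fun p hp ↦ h p ⟨mem_univ _, hp.2.1, ?_⟩⟩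
    · linarith [min_le_right t₁ t]
    · linarith [hp.2.2, min_le_left t₁ t]
  · rw [integral_fisherRao_moduliMap hg σ hl.1 v s, sub_self, abs_zero]
    have hv : 0 ≤ (euclideanMetric (EuclideanSpace ℝ (Fin 4))).val σ v v := by
      rw [euclideanMetric_apply]
      exact real_inner_self_nonneg (F := EuclideanSpace ℝ (Fin 4))
    have hl2 : 0 < l ^ 2 := by have := hl.1; positivity
    positivity

end BPST

end Literature.Geometry.GaugeTheory

end
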